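import Summits.Ventures.HodgeRepro2.T7SupportBergmanRegularPoint

/-!
# A dense subgroup meets the regular non-vanishing locus (support, seat p1)

The glue between «the bi-period is a non-zero continuous function of `γ`» and «a RATIONAL `γ₀`, regular, with
non-zero bi-period», in two layers.

ABSTRACT (any topological space `G`): a dense set `S` meets every non-empty open set, so if `F : G → ℂ` is
continuous and not identically zero and `Z ⊆ G` is closed with empty interior, then some `s ∈ S` has `F s ≠ 0`
and `s ∉ Z` (`exists_mem_dense_ne_zero_notMem`): `{F ≠ 0} \ Z` is open and non-empty. A zero set
`{c = 0}` has empty interior as soon as every point is a limit of points where `c ≠ 0`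
(`interior_eq_empty_of_frequently`). With `S = G(F)` dense in the archimedean group (weak approximation — a
PRINTED input, not here), `F` the archimedean bi-period and `Z` the non-regular locus, this is the choice of
`γ₀` of the line's §2.

MODEL (`SU(1,1)`, tori `K` and `h K h⁻¹`, `T7SupportBergmanRegularPoint`): the bi-period
`γ ↦ ∫_K ∫_K ⟨π_k(rot u · γ · h rot v h⁻¹) π_k(h) zⁿ, zⁿ⟩_k u^{k+2n} conj(v^{−(k+2n)})` is continuous in `γ`
(`continuous_torusOrbital`: it is `⟨π_k(γ h) zⁿ, zⁿ⟩_k`), the invariant `κ` is continuous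
(`continuous_kappa`), the non-regular locus `{κ = 1} = K h⁻¹` has empty interior
(`interior_kappa_eq_one_eq_empty`: `γ h a_t h⁻¹ → γ` with `κ ≠ 1` for `t ≠ 0`), and the regular
non-vanishing locus `{κ ≠ 1} ∩ {bi-period ≠ 0}` is open and non-empty (`isOpen_regularNonvanishing`,
row 678). Hence EVERY dense `S ⊆ SU(1,1)` contains a `γ₀` with `κ(γ₀) ≠ 1` and non-zero bi-period
(`exists_mem_dense_regular_torusOrbital_ne_zero`), and, through the abstract layer, so does every dense `S`
for ANY continuous function not identically zero — e.g. one known to be non-zero only at the non-regular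
point `h⁻¹` of row 673 (`exists_mem_dense_ne_zero_kappa_ne_one`).

Explicit model only; nothing about the adelic group, weak approximation for it, or any period.
Blind lane: Mathlib + the HodgeRepro2 prefix only; no sorry; axioms ⊆ {propext, Classical.choice, Quot.sound}.
-/

namespace Summit.Ventures.HodgeRepro2.T7SupportDenseRegularPoint

open Filter Topology MeasureTheory
open T5PoincareDensity T5SU11Unimodular T5SU11Fibration T5SU11Cartan T5SU11OneParameter
  T5SU11HyperbolicSubgroup T5BergmanCoefficient T5BergmanMatrixCoeff T5HaarCircle
  T7SupportBergmanTorusOrbital T7SupportBergmanConjTorus T7SupportKappaCartan T7SupportBergmanRegularPoint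

/-! ### The abstract layer -/

section Abstract

variable {G : Type*} [TopologicalSpace G]

/-- the non-vanishing set of a continuous function is open -/
theorem isOpen_ne_zero {F : G → ℂ} (hF : Continuous F) : IsOpen {g | F g ≠ 0} :=
  isOpen_ne_fun hF continuous_const

/-- a non-empty open set is not contained in a set with empty interior -/
theorem exists_mem_notMem_of_interior_eq_empty {U Z : Set G} (hU : IsOpen U) (hne : U.Nonempty)
    (hZ : interior Z = ∅) : ∃ g ∈ U, g ∉ Z := by
  by_contra hcon
  have hUZ : U ⊆ Z := fun g hg => Classical.byContradiction fun hgZ => hcon ⟨g, hg, hgZ⟩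
  have hsub : U ⊆ interior Z := interior_maximal hUZ hU
  rw [hZ] at hsub
  obtain ⟨g, hg⟩ := hne
  exact hsub hg

/-- **a dense set contains a point outside `Z` where `F` does not vanish**: `F` continuous and not
identically zero, `Z` closed with empty interior. -/
theorem exists_mem_dense_ne_zero_notMem {S : Set G} (hS : Dense S) {F : G → ℂ} (hF : Continuous F)
    (hne : ∃ g, F g ≠ 0) {Z : Set G} (hZc : IsClosed Z) (hZ : interior Z = ∅) :
    ∃ s ∈ S, F s ≠ 0 ∧ s ∉ Z := by
  have hU : IsOpen ({g | F g ≠ 0} \ Z) := (isOpen_ne_zero hF).sdiff hZc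
  obtain ⟨g, hg, hgZ⟩ := exists_mem_notMem_of_interior_eq_empty (isOpen_ne_zero hF) hne hZ
  obtain ⟨s, hsS, hsU⟩ := hS.exists_mem_open hU ⟨g, hg, hgZ⟩
  exact ⟨s, hsS, hsU.1, hsU.2⟩

/-- the same without the exceptional set -/
theorem exists_mem_dense_ne_zero {S : Set G} (hS : Dense S) {F : G → ℂ} (hF : Continuous F)
    (hne : ∃ g, F g ≠ 0) : ∃ s ∈ S, F s ≠ 0 := by
  obtain ⟨s, hsS, hs⟩ := hS.exists_mem_open (isOpen_ne_zero hF) hne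
  exact ⟨s, hsS, hs⟩

/-- **a zero set has empty interior** when every point is a limit of points where `c ≠ 0` -/
theorem interior_eq_empty_of_frequently {c : G → ℂ} (h : ∀ g, ∃ᶠ g' in 𝓝 g, c g' ≠ 0) :
    interior {g | c g = 0} = ∅ := by
  ext g
  simp only [Set.mem_empty_iff_false, iff_false]
  intro hg
  have hnhds : ∀ᶠ g' in 𝓝 g, c g' = 0 := mem_interior_iff_mem_nhds.1 hg
  obtain ⟨g', hg'⟩ := ((h g).and_eventually hnhds).exists
  exact hg'.1 hg'.2

end Abstract

/-! ### The model: `SU(1,1)`, tori `K` and `h K h⁻¹` -/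

section Model

variable [MeasurableSpace Circle] [BorelSpace Circle]

/-- the bi-torus orbital integral at `γ` (vectors `π_k(h) zⁿ`, `zⁿ`; characters `k + 2n`, `−(k + 2n)`) -/
noncomputable def torusOrbital (k n : ℕ) (h γ : SU11) : ℂ :=
  ∫ u : Circle, ∫ v : Circle,
    matrixCoeff k (act k h (fun w => w ^ n)) (fun w => w ^ n) (rot u * γ * (h * rot v * h⁻¹)) *
      ((u : ℂ) ^ ((k + 2 * n : ℕ) : ℤ) * (starRingEnd ℂ) ((v : ℂ) ^ (-(k + 2 * n : ℕ) : ℤ)))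
      ∂haarCircle ∂haarCircle

/-- the orbital integral is the diagonal coefficient at `γ h` -/
theorem torusOrbital_eq (k n : ℕ) (hk : 2 ≤ k) (h γ : SU11) :
    torusOrbital k n h γ = matrixCoeff k (fun w => w ^ n) (fun w => w ^ n) (γ * h) := by
  unfold torusOrbital
  rw [torus_orbital_conj_eq k n n hk h γ, if_pos rfl, if_pos rfl, one_mul, one_mul]

/-- **the orbital integral is continuous in `γ`** -/
theorem continuous_torusOrbital (k n : ℕ) (hk : 2 ≤ k) (h : SU11) :
    Continuous (torusOrbital k n h) := by
  have e : torusOrbital k n h = fun γ => matrixCoeff k (fun w => w ^ n) (fun w => w ^ n) (γ * h) :=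
    funext (torusOrbital_eq k n hk h)
  rw [e]
  exact (continuous_diagCoeff k n hk).comp (continuous_id.mul continuous_const)

omit [MeasurableSpace Circle] [BorelSpace Circle] in
/-- the invariant `κ` is continuous in `γ` -/
theorem continuous_kappa (h : SU11) :
    Continuous fun γ : SU11 => T7SupportTwoTorusInvariant.kappa (starRingEnd ℂ) dd (colBasis h) (mat γ) := by
  have e : (fun γ : SU11 => T7SupportTwoTorusInvariant.kappa (starRingEnd ℂ) dd (colBasis h) (mat γ)) =
      fun γ => ((Complex.normSq (mat (γ * h) 0 0) : ℝ) : ℂ) := funext fun γ => kappa_eq_normSq γ h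
  rw [e]
  exact Complex.continuous_ofReal.comp (Complex.continuous_normSq.comp
    (continuous_mat_zero_zero.comp (continuous_id.mul continuous_const)))

/-- the regular non-vanishing locus -/
def regularNonvanishing (k n : ℕ) (h : SU11) : Set SU11 :=
  {γ | T7SupportTwoTorusInvariant.kappa (starRingEnd ℂ) dd (colBasis h) (mat γ) ≠ 1 ∧ torusOrbital k n h γ ≠ 0}

/-- **the regular non-vanishing locus is open** -/
theorem isOpen_regularNonvanishing (k n : ℕ) (hk : 2 ≤ k) (h : SU11) :
    IsOpen (regularNonvanishing k n h) :=
  (isOpen_ne_fun (continuous_kappa h) continuous_const).inter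
    (isOpen_ne_fun (continuous_torusOrbital k n hk h) continuous_const)

/-- **the regular non-vanishing locus is non-empty** (row 678) -/
theorem nonempty_regularNonvanishing (k n : ℕ) (hk : 2 ≤ k) (h : SU11) :
    (regularNonvanishing k n h).Nonempty := by
  obtain ⟨γ₀, h1, h2⟩ := exists_regular_torus_orbital_ne_zero k n hk h
  exact ⟨γ₀, h1, h2⟩

/-- **every dense subset of `SU(1,1)` contains a regular `γ₀` with non-zero bi-period** -/
theorem exists_mem_dense_regular_torusOrbital_ne_zero (k n : ℕ) (hk : 2 ≤ k) (h : SU11) {S : Set SU11}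
    (hS : Dense S) :
    ∃ γ₀ ∈ S, T7SupportTwoTorusInvariant.kappa (starRingEnd ℂ) dd (colBasis h) (mat γ₀) ≠ 1 ∧
      torusOrbital k n h γ₀ ≠ 0 := by
  obtain ⟨s, hsS, hs⟩ := hS.exists_mem_open (isOpen_regularNonvanishing k n hk h)
    (nonempty_regularNonvanishing k n hk h)
  exact ⟨s, hsS, hs⟩

/-! ### The non-regular locus `{κ = 1} = K h⁻¹` has empty interior -/

omit [MeasurableSpace Circle] [BorelSpace Circle] in
/-- the entry `d(g)` of `g ∈ SU(1,1)` is non-zero (`|d|² = 1 + |b|²`) -/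
theorem mat_one_one_ne_zero (g : SU11) : mat g 1 1 ≠ 0 := by
  obtain ⟨-, -, -, e11⟩ := memU11_entries (memU11_mat g)
  intro hd
  rw [hd] at e11
  -- `conj(b) b − 0 = −1`: impossible since `conj(b) b = |b|² ≥ 0`
  have e : ((Complex.normSq (mat g 0 1) : ℝ) : ℂ) = -1 := by
    rw [Complex.normSq_eq_conj_mul_self]
    simpa using e11
  have e' : Complex.normSq (mat g 0 1) = -1 := by exact_mod_cast e
  linarith [Complex.normSq_nonneg (mat g 0 1)]

omit [MeasurableSpace Circle] [BorelSpace Circle] in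
/-- the `(1, 0)`-entry of `g a_t` is `c(g) cosh t + d(g) sinh t` -/
theorem mat_mul_hyp_one_zero (g : SU11) (t : ℝ) :
    mat (g * hyp t) 1 0 = mat g 1 0 * (Real.cosh t : ℂ) + mat g 1 1 * (Real.sinh t : ℂ) := by
  rw [mat_mul, mat_hyp]
  simp [su11, Matrix.mul_apply, Fin.sum_univ_two, Complex.conj_ofReal, -Complex.ofReal_sinh,
    -Complex.ofReal_cosh]

omit [MeasurableSpace Circle] [BorelSpace Circle] in
/-- the perturbation `γ h a_t h⁻¹` of a non-regular `γ` (`γ h ∈ K`) is regular for `t ≠ 0` -/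
theorem kappa_perturb_ne_one (h γ : SU11) (hγ : mat (γ * h) 1 0 = 0) {t : ℝ} (ht : t ≠ 0) :
    T7SupportTwoTorusInvariant.kappa (starRingEnd ℂ) dd (colBasis h) (mat (γ * h * hyp t * h⁻¹)) ≠ 1 := by
  rw [Ne, kappa_eq_one_iff, inv_mul_cancel_right, mat_mul_hyp_one_zero, hγ, zero_mul, zero_add]
  refine mul_ne_zero (mat_one_one_ne_zero _) ?_
  rw [Ne, Complex.ofReal_eq_zero]
  exact Real.sinh_ne_zero.2 ht

omit [MeasurableSpace Circle] [BorelSpace Circle] in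
/-- `t ↦ γ h a_t h⁻¹` is continuous with value `γ` at `t = 0` -/
theorem tendsto_perturb (h γ : SU11) :
    Tendsto (fun t : ℝ => γ * h * hyp t * h⁻¹) (𝓝 0) (𝓝 γ) := by
  have hc : Continuous fun t : ℝ => γ * h * hyp t * h⁻¹ :=
    (continuous_const.mul continuous_hyp).mul continuous_const
  have h0 : γ * h * hyp 0 * h⁻¹ = γ := by
    rw [hyp_zero, mul_one, mul_inv_cancel_right]
  simpa only [h0] using hc.tendsto 0

omit [MeasurableSpace Circle] [BorelSpace Circle] in
/-- **every point of `SU(1,1)` is a limit of regular points** -/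
theorem frequently_kappa_ne_one (h γ : SU11) :
    ∃ᶠ γ' in 𝓝 γ, T7SupportTwoTorusInvariant.kappa (starRingEnd ℂ) dd (colBasis h) (mat γ') ≠ 1 := by
  by_cases hγ : mat (γ * h) 1 0 = 0
  · -- non-regular: perturb along `a_t`, `t > 0`
    have htend : Tendsto (fun t : ℝ => γ * h * hyp t * h⁻¹) (𝓝[>] 0) (𝓝 γ) :=
      (tendsto_perturb h γ).mono_left nhdsWithin_le_nhds
    refine htend.frequently ?_
    refine (eventually_mem_nhdsWithin.mono fun t (ht : t ∈ Set.Ioi (0 : ℝ)) => ?_).frequently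
    exact kappa_perturb_ne_one h γ hγ (ne_of_gt ht)
  · -- regular: `κ ≠ 1` at `γ` itself, and nearby by continuity
    have hne : T7SupportTwoTorusInvariant.kappa (starRingEnd ℂ) dd (colBasis h) (mat γ) ≠ 1 := by
      rw [Ne, kappa_eq_one_iff]
      exact hγ
    exact ((continuous_kappa h).continuousAt.eventually_ne hne).frequently

omit [MeasurableSpace Circle] [BorelSpace Circle] in
/-- **the non-regular locus has empty interior** -/
theorem interior_kappa_eq_one_eq_empty (h : SU11) :
    interior {γ : SU11 | T7SupportTwoTorusInvariant.kappa (starRingEnd ℂ) dd (colBasis h) (mat γ) = 1} = ∅ := by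
  have e : {γ : SU11 | T7SupportTwoTorusInvariant.kappa (starRingEnd ℂ) dd (colBasis h) (mat γ) = 1} =
      {γ : SU11 | T7SupportTwoTorusInvariant.kappa (starRingEnd ℂ) dd (colBasis h) (mat γ) - 1 = 0} := by
    ext γ
    simp only [Set.mem_setOf_eq, sub_eq_zero]
  rw [e]
  refine interior_eq_empty_of_frequently fun γ => ?_
  exact (frequently_kappa_ne_one h γ).mono fun γ' hγ' => sub_ne_zero.2 hγ'

omit [MeasurableSpace Circle] [BorelSpace Circle] in
/-- the non-regular locus is closed -/
theorem isClosed_kappa_eq_one (h : SU11) :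
    IsClosed {γ : SU11 | T7SupportTwoTorusInvariant.kappa (starRingEnd ℂ) dd (colBasis h) (mat γ) = 1} :=
  isClosed_eq (continuous_kappa h) continuous_const

omit [MeasurableSpace Circle] [BorelSpace Circle] in
/-- **any continuous function on `SU(1,1)` not identically zero is non-zero at a regular point of every dense
subset** — the non-vanishing may be known at a non-regular point (e.g. row 673's `γ = h⁻¹`) -/
theorem exists_mem_dense_ne_zero_kappa_ne_one (h : SU11) {S : Set SU11} (hS : Dense S) {F : SU11 → ℂ}
    (hF : Continuous F) (hne : ∃ γ, F γ ≠ 0) :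
    ∃ γ₀ ∈ S, F γ₀ ≠ 0 ∧ T7SupportTwoTorusInvariant.kappa (starRingEnd ℂ) dd (colBasis h) (mat γ₀) ≠ 1 := by
  obtain ⟨s, hsS, hs, hsZ⟩ := exists_mem_dense_ne_zero_notMem hS hF hne (isClosed_kappa_eq_one h)
    (interior_kappa_eq_one_eq_empty h)
  exact ⟨s, hsS, hs, hsZ⟩

end Model

end Summit.Ventures.HodgeRepro2.T7SupportDenseRegularPoint
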